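import Summits.QuantumFields.YangMills.Theorems.BalabanUVNodesN10AtRecord11B13Walks
import Literature.MathematicalPhysics.QuantumFieldTheory.Balaban1983to89.Node00.CarriersB13KernelTower

/-!
# BalabanUVNodes ∕ N10 AT NODE 00's KERNEL TOWER OF RECORD — the [B13] leaf of [Balaban1988RG2Cluster] Lemmas 1–3 at the LAYER OF RECORD `lamK.layer` of a
# kernel-keyed residual layer `lamK : Node00.ResidB13K θ` (node00-def-B13 g4, `Node00/CarriersB13KernelTower` p484227): dag-n10-c's walks junction
# `…N10AtRecord11B13Walks.b13LeafOfRecord_of_located_walks` with its THIRTEEN dictionary data PINNED to the tower's fields and its NINE dictionary laws DISCHARGED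
# by def-B13's theorems — what remains displayed is exactly the located inputs of Lemmas 1–2, the Lemma-3 numerics ∕ domains, the record's bond∕cube maps, NODE A's
# structural inputs and THE RUNG `TermWalks (lamK.𝒦 Z t) q` on the kernels OF RECORD (Track A, DAG node N10 [B13]; strategy s2 «by-name knit at the record»; seat
# `pub-ymgap-dag-n10-d` g5; def-B13 g4's CONSUMER RECIPE, bus l.15156 ∕ l.15250, kernel-certified there as `scratch_junction.junctionAtLayerTest`)

HONEST FRAMING.  Count-neutral kernel bookkeeping over LANDED modules: node00-def-B13 g4's `Node00/CarriersB13KernelTower` (p484227 ✓ 838e3b7d6ea1: the kernel-keyed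
layer `ResidB13K θ` — every field of g0's `ResidB13 θ` but `T₃`, plus [13]'s site torus `UT Nf`, the kernels' configuration space `E₃`, NODE A's per-term kernel record
`𝒦 Z t : TermKernels {c with L := θ.ℓ₆+1} 4 (n+1) ν Nf E₃`, the configuration reading `uOf`, the Cauchy radius `r`, the χ-bond sets `Y0l`, `Pl`, the embedding `emb` —,
its (2.14) TERM OF RECORD `T₃ := term214 r (lZ Z t) (lD t) (core Z t φ) 0 0` and LAYER OF RECORD `layer : ResidB13 θ`, and the dictionary theorems `norm_T₃_layer_le`,
`lZ_spec`, `lD_spec`, `Gam_eq`, `chicP_eq`, `chiY₀_nonneg`, `chiY₀_le_one`, `Vr_eq`, `rP_nonneg`) and dag-n10-c g2's `…N10AtRecord11B13Walks` (p473615: the walks junction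
at the group of record, 13 dictionary data + 9 dictionary laws among its binders).  THIS FILE is def-B13's CONSUMER RECIPE as ONE theorem: the junction AT
`lam := lamK.layer` with `𝒦 := lamK.𝒦`, `uOf := lamK.uOf`, `r := lamK.r`, `lZ := lamK.lZ`, `lD := fun _ t => lamK.lD t`, `Γm := lamK.Gam`, `χY₀ := lamK.chiY₀`,
`χcP := lamK.chicP`, `Pl := lamK.Pl`, `rP := lamK.rP = ε₁∕‖g‖`, `Dfam := fun _ t => t.1` (print: Σ_{Y ∈ 𝐃}), `Vr := lamK.Vr`, `emb := lamK.emb`, and the laws `hT₃` (`le_rfl`: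
THE LAYER's TERM **IS** THE (2.14) X-INTEGRAL OF THE KERNELS OF RECORD), `hlZ`, `hlD`, `hlin`, `hχc`, `hχ0`, `hχ1`, `hVr`, `hrP` (from `0 < ε₁`) GONE.  WHAT REMAINS (displayed,
verbatim from the junction at the layer of record): LEMMA 1 (pp. 7–9) and LEMMA 2 (pp. 10–11) — the located per-term inputs (block geometry, analyticity on (1.34),
thresholds ∕ R8 ∕ R9 on `lamK.c`, the in-edges (1.24)∕(1.30) `h124 ∕ h130` BY REFERENCE, `hC`, the curvature terms, the (1.38)∕(1.39) data, the floor, gauge invariance by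
assertion); LEMMA 3 (pp. 14–20) — `12 ≤ L·(n+1)`, `8 ≤ L`, the numerics bundle at ℓ = ½L, R12, the signs, the domains `Uσ, Uτ` around the tower's radius `lamK.r`, the
configuration size `α`, `|Pl Z t| = |P|`, the record's bond ∕ cube maps `ιb, cube` with the consistency of `lamK.emb` (`hBv hBv0`) and `hQsupp hfibc`, the support clause
`hχsupp`, separate holomorphy `hΨσ hΨτ`, NODE A's `hAs hΓq`, the fibre bounds, THE RUNG `TermWalks (lamK.𝒦 Z t) q` for every term with ONE admissible package and its
letters, print's two thresholds, the rate chain, NODE A's `ϑ`, the (2.24)–(2.25) smallness, `hPa`, `hvol`.  So at THIS pin the content of N10 reads: located per-term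
inputs of Lemmas 1–2 about the HIDDEN frame + [13]'s walk expansions FOR THE KERNELS OF RECORD `lamK.𝒦` (NODE A ∕ N06 s4 ∕ dag-n10-c's conditioning storey — NOT
supplied) + numerics.  Honesty as in def-B13 §3: at kernel data with a P-bond among the Y₀-bonds the H of record VANISHES (`H_layer_eq_zero_of_forall_exists_mem`) and the
zero-tower species re-appears one storey down — the theorem below is then about a layer with H = 0; nothing here excludes it (print's `P ⊂ Y₀ᶜ*` is a law the data
does not carry).  Nothing of Bałaban's is asserted; N10 is NOT discharged; K0′ untouched; no node count moves; Stage-3-keyed (record-stage-generic: the ₁₂ ∕ ₁₃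
pins `Stage12Params.pinB13K` ∕ its successor apply to `lamK.layer` BY NAME through `…N10AtRecord12B13.b13_main_at_pinB13₁₂_of_leafOfRecord`); one finite four-torus
programme at fixed ε per run; nothing continuum ∕ ℝ⁴ ∕ OS ∕ mass-gap ∕ Clay.  0 `sorry`, 0 `def`, standard axioms.  Filed `--supports` K1′ «StabilityBAtRecordR12e»
(stmt-QuantumFields-19903) of route «BalabanUVNodes».

WHAT THIS FILE PROVES.  §1 `b13LeafOfRecord_layer_of_located_walks` (the junction at the layer of record, dictionary pinned ∕ discharged ⟹ `B13LeafOfRecord θ lamK.layer`);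
§2 `b13FamLeafOfRecord_layerFam_of_forall` (the family currency: member-wise leaves of a kernel-keyed family ⟹ `B13FamLeafOfRecord θ γ₀ lamKF.layerFam c₀`, def-B13 g3's
bridge at `layerFam` by name — stated once so the consumer sees the member letters law it owes).
-/

namespace Summit.QuantumFields.YangMills.BalabanUVNodes.N10B13KernelTowerWalks

open Literature.MathematicalPhysics.QuantumFieldTheory.Balaban1983to89
open Literature.MathematicalPhysics.QuantumFieldTheory.Balaban1983to89.DagBinding
open Literature.MathematicalPhysics.QuantumFieldTheory.Balaban1983to89.Node00
open Literature.MathematicalPhysics.QuantumFieldTheory.Balaban1983to89.B13Lemma3Torus (TwoTorusStep)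
open Literature.MathematicalPhysics.QuantumFieldTheory.Balaban1983to89.B13Lemma3TorusSocket (TermDomination Lemma3Numerics)
open Literature.MathematicalPhysics.QuantumFieldTheory.Balaban1983to89.B13Lemma3TorusData
open Metric
open Literature.MathematicalPhysics.QuantumFieldTheory.Balaban1983to89.B16Absorption (pbox)
open Literature.MathematicalPhysics.QuantumFieldTheory.Balaban1983to89.TreeLengthTorus
open Literature.MathematicalPhysics.QuantumFieldTheory.Balaban1983to89.TreeLengthTorusGeometry
open Literature.MathematicalPhysics.QuantumFieldTheory.Balaban1983to89.TreeLengthTorusTransfer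
open Literature.MathematicalPhysics.QuantumFieldTheory.Balaban1983to89.B12TreeDecay (kappa₀ K₀)
open Literature.MathematicalPhysics.QuantumFieldTheory.Balaban1983to89.B13PkScaling (Qop scaled)
open Literature.MathematicalPhysics.QuantumFieldTheory.Balaban1983to89.B13Bound143 (invTau R12)
open Literature.MathematicalPhysics.QuantumFieldTheory.Balaban1983to89.B13Term214 (term214 SepHolOn core214 F214)
open Literature.MathematicalPhysics.QuantumFieldTheory.Balaban1983to89.B13Lemma3TorusTerms (terms Z0)
open Literature.MathematicalPhysics.QuantumFieldTheory.Balaban1983to89.B5TorusCover (UT)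
open Literature.MathematicalPhysics.QuantumFieldTheory.Balaban1983to89.B13TermWalkData (TermKernels)
open Literature.MathematicalPhysics.QuantumFieldTheory.Balaban1983to89.NodeOLettersOfWalksAcross (WalkPackage TermWalks)
open Summit.QuantumFields.YangMills.BalabanUVNodes.N10AtRecord11B13Walks (b13LeafOfRecord_of_located_walks)
open scoped Matrix

/-! ## §1. THE WALKS JUNCTION AT THE LAYER OF RECORD OF A KERNEL-KEYED LAYER — dictionary pinned and discharged -/

section Layer

variable (θ : Stage3Params) (lamK : ResidB13K θ)

open Classical in
/-- **THE [B13] LEAF AT NODE 00's KERNEL TOWER OF RECORD — LEMMAS 1–2 FROM THEIR LOCATED INPUTS, LEMMA 3 FROM NODE A's W-WALKS RUNG ON THE KERNELS OF RECORD.**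
At Stage-3 parameters `θ` and a kernel-keyed residual layer `lamK : ResidB13K θ`, this is dag-n10-c's `b13LeafOfRecord_of_located_walks θ lamK.layer` with the
dictionary PINNED to the tower (`𝒦, uOf, r, lZ, lD, Gam, chiY₀, chicP, Pl, rP, 𝐃, Vr, emb`) and its nine laws DISCHARGED by node00-def-B13's theorems (`norm_T₃_layer_le` —
the layer's term IS the (2.14) X-integral of the kernels of record —, `lZ_spec`, `lD_spec`, `Gam_eq`, `chicP_eq`, `chiY₀_nonneg ∕ _le_one`, `Vr_eq`, `rP_nonneg hε.le`).
The remaining binders are the junction's, read at `lamK.layer` (whose frame fields ARE `lamK`'s: `ResidB13K.layer_n ∕ _k ∕ _c ∕ …`, `rfl`).  CONCLUSION: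
`B13LeafOfRecord θ lamK.layer` — to which every g0 ∕ g2 ∕ g3 face of NODE 00 and this seat's ₁₁ ∕ ₁₂ ∕ family storeys apply BY NAME.  Count-neutral: hypotheses about
the HIDDEN frame and NODE A's kernels of record; nothing of Bałaban's is asserted.
[cite: Balaban1988RG2Cluster, Lemma 1 p.9, Lemma 2 p.11, Lemma 3 p.20, (2.3) p.12, p.13, (2.14)–(2.26) pp.15–17; Balaban1985BackgroundPropagators, Thm 3.10 p.416] -/
theorem b13LeafOfRecord_layer_of_located_walks
    (hN12 : 12 ≤ (θ.ℓ₆ + 1) * (lamK.layer.n + 1))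
    -- (1) LEMMA 1: [I]'s block geometry of the (1.33) index families of the layer
    (dist : TDom 4 ((θ.ℓ₆ + 1) * (lamK.layer.n + 1)) → TPt 4 ((θ.ℓ₆ + 1) * (lamK.layer.n + 1)) → (j : ℕ) →
      TPt 4 ((θ.ℓ₆ + 1) ^ (lamK.layer.k - j) * ((θ.ℓ₆ + 1) * (lamK.layer.n + 1))) → ℝ) {K K' : ℝ}
    (hS0Y : ∀ Y, ∀ a ∈ lamK.layer.S0 Y,
      (pbox (fun i => natLift a i - (5 : ℕ)) (fun i => natLift a i + 1 + (5 : ℕ))).image (proj ((θ.ℓ₆ + 1) * (lamK.layer.n + 1))) ⊆ Y.1)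
    (hFsub : ∀ Y a, lamK.layer.F Y a ⊆
      (pbox (fun i => natLift a i - (5 : ℕ)) (fun i => natLift a i + 1 + (5 : ℕ))).image (proj ((θ.ℓ₆ + 1) * (lamK.layer.n + 1))) \
        (pbox (fun i => natLift a i - (4 : ℕ)) (fun i => natLift a i + 1 + (4 : ℕ))).image (proj ((θ.ℓ₆ + 1) * (lamK.layer.n + 1))))
    (hSq : ∀ Y, ∀ a ∈ lamK.layer.S0 Y, ∀ j, lamK.layer.Sq Y a j ⊆
      (Finset.univ : Finset (TPt 4 ((θ.ℓ₆ + 1) ^ (lamK.layer.k - j) * ((θ.ℓ₆ + 1) * (lamK.layer.n + 1))))).filter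
        (fun q => tcoarse ((θ.ℓ₆ + 1) ^ (lamK.layer.k - j)) ((θ.ℓ₆ + 1) * (lamK.layer.n + 1)) q ∈
          (pbox (fun i => natLift a i - (2 : ℕ)) (fun i => natLift a i + 1 + (2 : ℕ))).image (proj ((θ.ℓ₆ + 1) * (lamK.layer.n + 1)))))
    (hScY : ∀ Y, lamK.layer.Sc Y ⊆ Y.1)
    (hdist0 : ∀ Y a j q, 0 ≤ lamK.layer.c.δ₀ * dist Y a j q)
    (hdist : ∀ Y a j (n : ℕ) q, q ∉ (pbox (fun i => (((θ.ℓ₆ + 1) ^ (lamK.layer.k - j) : ℕ) : ℤ) * natLift a i - (n + 1 : ℕ))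
      (fun i => (((θ.ℓ₆ + 1) ^ (lamK.layer.k - j) : ℕ) : ℤ) * natLift a i + 2 * (((θ.ℓ₆ + 1) ^ (lamK.layer.k - j) : ℕ) : ℤ) - 1 + (n + 1 : ℕ))).image
        (proj ((θ.ℓ₆ + 1) ^ (lamK.layer.k - j) * ((θ.ℓ₆ + 1) * (lamK.layer.n + 1)))) → lamK.layer.c.δ₀ * lamK.layer.c.M * ((n : ℝ) + 1) ≤ lamK.layer.c.δ₀ * dist Y a j q)
    (hSX : ∀ Y a j q, lamK.layer.SX Y a j q ⊆ (tcubeSys 4 ((θ.ℓ₆ + 1) ^ (lamK.layer.k - j) * ((θ.ℓ₆ + 1) * (lamK.layer.n + 1)))).above q)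
    (hSX' : ∀ Y a j q, lamK.layer.SX' Y a j q ⊆ (tcubeSys 4 ((θ.ℓ₆ + 1) ^ (lamK.layer.k - j) * ((θ.ℓ₆ + 1) * (lamK.layer.n + 1)))).above q)
    (hX0 : ∀ Y, ∀ a ∈ lamK.layer.Sc Y, ∀ j ∈ Finset.range (lamK.layer.k + 1), ∀ q ∈ lamK.layer.Sq' Y a j, ∀ x ∈ lamK.layer.SX' Y a j q,
      x.1.image (tcoarse ((θ.ℓ₆ + 1) ^ (lamK.layer.k - j)) ((θ.ℓ₆ + 1) * (lamK.layer.n + 1))) ⊆ Y.1)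
    -- (1) LEMMA 1: per-term analyticity on (1.34)
    (hAnT : ∀ Y, ∀ a ∈ lamK.layer.S0 Y, ∀ X ∈ (lamK.layer.F Y a).powerset, ∀ j ∈ Finset.range (lamK.layer.k + 1), ∀ q ∈ lamK.layer.Sq Y a j,
      ∀ x ∈ lamK.layer.SX Y a j q, AnalyticOnNhd ℂ (lamK.layer.T Y a X j q x) (lamK.layer.sp1 Y))
    (hAnT' : ∀ Y, ∀ a ∈ lamK.layer.Sc Y, ∀ j ∈ Finset.range (lamK.layer.k + 1), ∀ q ∈ lamK.layer.Sq' Y a j, ∀ x ∈ lamK.layer.SX' Y a j q,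
      AnalyticOnNhd ℂ (lamK.layer.T' Y a j q x) (lamK.layer.sp1 Y))
    -- (1) LEMMA 1: thresholds and restrictions on the residual constants
    (hK : 0 ≤ K) (hK' : 0 ≤ K') (hκ : 0 ≤ lamK.layer.c.κ) (hδ1 : lamK.layer.c.δ < 1) (hδκ : 1 ≤ lamK.layer.c.δ * lamK.layer.c.κ)
    (hκ126 : kappa₀ 64 8 ≤ lamK.layer.c.κ) (hκ126' : kappa₀ 64 8 ≤ lamK.layer.c.δ * lamK.layer.c.κ)
    (hκ₁ : 1 + 2 * Real.log (8 * 12 ^ 3) ≤ lamK.layer.c.κ₁) (hκ₁' : 2 + 16 * Real.log 128 ≤ lamK.layer.c.κ₁)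
    (hδ₀M : 10 * Real.exp (-1) ≤ lamK.layer.c.δ₀ * lamK.layer.c.M) (hδ₀M5 : 2 * Real.log 5 ≤ lamK.layer.c.δ₀ * lamK.layer.c.M)
    (hR8 : (1 - lamK.layer.c.δ) * lamK.layer.c.κ ≤ (1 / 4) * (lamK.layer.c.κ₁ - 1)) (hR9 : (1 - 2 * lamK.layer.c.δ) * lamK.layer.c.κ ≤ (1 / 16) * lamK.layer.c.κ₁)
    -- (1) LEMMA 1: per-term (1.24), (1.30) by reference to [I] (3.54), (3.17), [15] Prop. 4, [13] (3.108); the constants with headroom (1 − θ₁)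
    (h124 : ∀ Y φ, φ ∈ lamK.layer.sp1 Y → ∀ a ∈ lamK.layer.S0 Y, ∀ X ∈ (lamK.layer.F Y a).powerset, ∀ j ∈ Finset.range (lamK.layer.k + 1), ∀ q ∈ lamK.layer.Sq Y a j,
      ∀ x ∈ lamK.layer.SX Y a j q,
        ‖lamK.layer.T Y a X j q x φ‖ ≤ K * (((θ.ℓ₆ + 1 : ℕ) : ℝ) ^ j * (((θ.ℓ₆ + 1 : ℕ) : ℝ) ^ lamK.layer.k)⁻¹) ^ 5 *
          Real.exp (-(lamK.layer.c.κ₁ - 1) *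
            (((Y.1 \ (pbox (fun i => natLift a i - (5 : ℕ)) (fun i => natLift a i + 1 + (5 : ℕ))).image
              (proj ((θ.ℓ₆ + 1) * (lamK.layer.n + 1)))).card : ℝ) + X.card)) *
          Real.exp (-(lamK.layer.c.κ * torusTreeLen x.1)))
    (h130 : ∀ Y φ, φ ∈ lamK.layer.sp1 Y → ∀ a ∈ lamK.layer.Sc Y, ∀ j ∈ Finset.range (lamK.layer.k + 1), ∀ q ∈ lamK.layer.Sq' Y a j,
      ∀ x ∈ lamK.layer.SX' Y a j q,
        ‖lamK.layer.T' Y a j q x φ‖ ≤ K' * Real.exp (-(1 / 2) * (lamK.layer.c.δ₀ * lamK.layer.c.M) * (((θ.ℓ₆ + 1 : ℕ) : ℝ) ^ j * (((θ.ℓ₆ + 1 : ℕ) : ℝ) ^ lamK.layer.k)⁻¹)⁻¹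
            - (1 / 2) * lamK.layer.c.δ₀ * dist Y a j q) *
          Real.exp (-(lamK.layer.c.κ₁ - 1) * ((Y.1 \ x.1.image (tcoarse ((θ.ℓ₆ + 1) ^ (lamK.layer.k - j)) ((θ.ℓ₆ + 1) * (lamK.layer.n + 1)))).card : ℝ)) *
          Real.exp (-(lamK.layer.c.κ * torusTreeLen x.1)))
    {θ₁ : ℝ} (hθ₁0 : 0 ≤ θ₁) (hθ₁1 : θ₁ < 1)
    (hC : K * K₀ 64 8 * (2 * (6 * ((θ.ℓ₆ + 1 : ℕ) : ℝ)) ^ 4) * Real.exp 1 * Real.exp ((1 / 8) * lamK.layer.c.κ₁ * (12 ^ 4 - 1)) +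
        2 * (64 * K') * K₀ 64 8 * 1344 ≤
      (1 - θ₁) * (lamK.layer.c.E₀ * lamK.layer.c.ε₁ * lamK.layer.c.C₁ * lamK.layer.c.M ^ lamK.layer.c.q * Real.exp (lamK.layer.c.C₂ * lamK.layer.c.κ₁)))
    -- (2) LEMMA 2 (pp. 10–11): the curvature terms; the located per-term data of `B13Lemma2Torus.lemma2Printed_twoTorus'` for the layer's plaquette data
    (hGlAn : ∀ Y, AnalyticOnNhd ℂ (lamK.layer.Gl Y) (lamK.layer.sp1 Y))
    (hGl : ∀ Y φ, φ ∈ lamK.layer.sp1 Y → ‖lamK.layer.Gl Y φ‖ ≤ θ₁ * (lamK.layer.c.E₀ * lamK.layer.c.ε₁ * lamK.layer.c.C₁ * lamK.layer.c.M ^ lamK.layer.c.q * Real.exp (lamK.layer.c.C₂ * lamK.layer.c.κ₁)) *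
      Real.exp (-((1 - 2 * lamK.layer.c.δ) * lamK.layer.c.κ * (tsys 4 ((θ.ℓ₆ + 1) * (lamK.layer.n + 1))).dj Y)))
    (he : ∀ Y b, ‖lamK.layer.e Y b‖ ≤ 1) (hg : lamK.layer.g ≠ 0)
    {R K₂ : ℝ} {m₂ : ℕ} (hK₂ : 0 ≤ K₂) (hR : 0 < R) (hε3 : 3 * lamK.layer.c.ε₁ ≤ R)
    (hW : ∀ Y, ∀ i ∈ lamK.layer.s Y, ∀ φ ∈ lamK.layer.sp1 Y, AnalyticOnNhd ℂ (lamK.layer.Wf Y i φ) (ball 0 R))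
    (hKW : ∀ Y, ∀ i ∈ lamK.layer.s Y, ∀ φ ∈ lamK.layer.sp1 Y, ∀ z ∈ ball (0 : lamK.layer.E) R,
      ‖lamK.layer.Wf Y i φ z‖ ≤ K₂ * Real.exp (-(lamK.layer.c.κ₁ - 1) * ((Y.1.card : ℝ) - 1)) * ‖z‖ ^ 3)
    (hcard : ∀ Y, (lamK.layer.s Y).card ≤ m₂ * Y.1.card)
    (hsp : ∀ Y φ, φ ∈ lamK.layer.sp1 Y → ‖lamK.layer.g‖ * ‖lamK.layer.rd Y φ‖ < lamK.layer.c.ε₁)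
    (hfloor : 27 * m₂ * K₂ * Real.exp (lamK.layer.c.κ₁ - 1) ≤ lamK.layer.c.C₃ * lamK.layer.c.M ^ 4 * Real.exp (lamK.layer.c.C₂ * lamK.layer.c.κ₁))
    (hAnP : ∀ Y, ∀ i ∈ lamK.layer.s Y, AnalyticOnNhd ℂ (fun φ => scaled lamK.layer.g (lamK.layer.Wf Y i φ) (lamK.layer.rd Y φ)) (lamK.layer.sp1 Y))
    (hG : ∀ Y, lamK.layer.GaugeInv (lamK.layer.V Y) ∧ lamK.layer.GaugeInv ((WtOfRecord θ lamK.layer).toStepData.quadForm Y) ∧ lamK.layer.GaugeInv (lamK.layer.Vpp Y))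
    -- (3) LEMMA 3 (pp. 14–20): the signs of (2.18)–(2.20), R12, |τ(Y)| ≥ 2, and the numerics bundle at ℓ = ½L
    (hL8 : 8 ≤ θ.ℓ₆ + 1) {a a₂ a₂' a₅ Aabs : ℝ} (hN : Lemma3Numerics (c13OfRecord θ lamK.layer) (lamK.layer.m₃ + 1) (((θ.ℓ₆ + 1 : ℕ) : ℝ) / 2) a a₂ a₂' a₅ Aabs)
    (h12 : R12 (c13OfRecord θ lamK.layer)) (hE : 0 < lamK.layer.c.E₀) (hε : 0 < lamK.layer.c.ε₁) (hC₁ : 0 < lamK.layer.c.C₁) (hα : 0 < lamK.layer.c.α₄)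
    (hM : 1 ≤ lamK.layer.c.M)
    (hτ2 : lamK.layer.c.E₀ * lamK.layer.c.ε₁ * lamK.layer.c.C₁ * lamK.layer.c.α₄⁻¹ * lamK.layer.c.M ^ lamK.layer.c.q * Real.exp (lamK.layer.c.C₂ * lamK.layer.c.κ₁) ≤ 1 / 2)
    -- (3) the Cauchy radius and the parameter domains (p. 15)
    {Uσ Uτ : Set ℂ} (hUσ : IsOpen Uσ) (hUτ : IsOpen Uτ) (hUexp : Metric.closedBall (0 : ℂ) (Real.exp lamK.layer.c.κ₁) ⊆ Uσ)
    (hUtau : ∀ Y : TDom 4 ((θ.ℓ₆ + 1) * (lamK.layer.n + 1)), Metric.closedBall (0 : ℂ) ((invTau (c13OfRecord θ lamK.layer) ((tsys 4 ((θ.ℓ₆ + 1) * (lamK.layer.n + 1))).dj Y))⁻¹) ⊆ Uτ)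
    (hr : 0 < lamK.r) (hr' : lamK.r ≤ Real.exp lamK.layer.c.κ₁ - 1)
    (hsubτ : ∀ x ∈ Set.uIcc (0 : ℝ) 1, Metric.closedBall (x : ℂ) lamK.r ⊆ Uτ)
    -- (3) THE DICTIONARY IS def-B13's KERNEL TOWER (`lamK.𝒦 ∕ uOf ∕ r ∕ lZ ∕ lD ∕ Gam ∕ chiY₀ ∕ chicP ∕ Pl ∕ rP ∕ Vr ∕ emb`, `Dfam := 𝐃`): only the configuration size `α` stays
    {α : ℝ} (hαnn : 0 ≤ α) (huα : ∀ Z, ∀ t ∈ terms (θ.ℓ₆ + 1) (lamK.layer.m₃ + 1) Z, ∀ φ ∈ lamK.layer.sp2 Z, ‖lamK.uOf Z t φ‖ ≤ α)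
    -- (3) per term: the `|P|` row bonds (the χ-bond sets are data of the tower; their cardinality law stays located)
    (hPcard : ∀ Z, ∀ t ∈ terms (θ.ℓ₆ + 1) (lamK.layer.m₃ + 1) Z, (lamK.Pl Z t).card = t.2.card)
    -- (3) the record's objects behind the terms: bonds, cubes, the real field inside the configurations
    (ιb : (Z : TDom 4 (lamK.layer.n + 1)) → (t : Finset (TDom 4 ((θ.ℓ₆ + 1) * (lamK.layer.n + 1))) × Finset (TBond 4 (lamK.layer.m₃ + 1) ((θ.ℓ₆ + 1) * (lamK.layer.n + 1)))) → (lamK.𝒦 Z t).Λ → lamK.layer.Bond)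
    (hι : ∀ Z t, Function.Injective (ιb Z t)) (cube : lamK.layer.Bond → TPt 4 ((θ.ℓ₆ + 1) * (lamK.layer.n + 1)))
    (hQsupp : ∀ (Y : TDom 4 ((θ.ℓ₆ + 1) * (lamK.layer.n + 1))) φ b b', lamK.layer.Q Y φ b b' ≠ 0 → cube b ∈ Y.1 ∧ cube b' ∈ Y.1)
    {m' : ℕ} (hfibc : ∀ Z t (x : TPt 4 ((θ.ℓ₆ + 1) * (lamK.layer.n + 1))), (Finset.univ.filter fun j => cube (ιb Z t j) = x).card ≤ m')
    (hBv : ∀ Z t φ B b, lamK.layer.Bv (lamK.emb Z t φ B) (ιb Z t b) = (B b : ℂ))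
    (hBv0 : ∀ Z t φ B b', b' ∉ Set.range (ιb Z t) → lamK.layer.Bv (lamK.emb Z t φ B) b' = 0)
    (hχsupp : ∀ Z, ∀ t ∈ terms (θ.ℓ₆ + 1) (lamK.layer.m₃ + 1) Z, ∀ φ ∈ lamK.layer.sp2 Z, ∀ B, lamK.chiY₀ Z t B ≠ 0 → ∀ Y ∈ t.1,
      lamK.emb Z t φ B ∈ lamK.layer.sp1 Y)
    -- (3) separate holomorphy of the X-integral in (σ, τ)
    (hΨσ : ∀ Z, ∀ t ∈ terms (θ.ℓ₆ + 1) (lamK.layer.m₃ + 1) Z, ∀ φ ∈ lamK.layer.sp2 Z, ∀ τ : TDom 4 ((θ.ℓ₆ + 1) * (lamK.layer.n + 1)) → ℂ, (∀ j, τ j ∈ Uτ) →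
      SepHolOn Uσ (fun σ => core214 (fun σ => (lamK.𝒦 Z t).A2 σ (lamK.uOf Z t φ)) (lamK.Gam Z t φ)
        (F214 t.2.card (lamK.chiY₀ Z t) (lamK.chicP Z t) t.1 (lamK.Vr Z t φ)) σ τ))
    (hΨτ : ∀ Z, ∀ t ∈ terms (θ.ℓ₆ + 1) (lamK.layer.m₃ + 1) Z, ∀ φ ∈ lamK.layer.sp2 Z, ∀ σ : TPt 4 (lamK.layer.n + 1) → ℂ, (∀ j, σ j ∈ Uσ) →
      SepHolOn Uτ (fun τ => core214 (fun σ => (lamK.𝒦 Z t).A2 σ (lamK.uOf Z t φ)) (lamK.Gam Z t φ)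
        (F214 t.2.card (lamK.chiY₀ Z t) (lamK.chicP Z t) t.1 (lamK.Vr Z t φ)) σ τ))
    -- (3) NODE A's structural inputs at the configuration: A(σ) COMPLEX SYMMETRIC on the polydisc; Γ(σ) = G(σ)·
    --     (`Re A(σ) ≻ 0` is no longer asked: it follows from the rung's m_A-accretivity, `re_posDef_of_termWalks`)
    (hAs : ∀ Z, ∀ t ∈ terms (θ.ℓ₆ + 1) (lamK.layer.m₃ + 1) Z, ∀ φ ∈ lamK.layer.sp2 Z, ∀ σ : TPt 4 (lamK.layer.n + 1) → ℂ, (∀ j, ‖σ j‖ ≤ Real.exp lamK.layer.c.κ₁) →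
      ((lamK.𝒦 Z t).A2 σ (lamK.uOf Z t φ)).IsSymm)
    {γ₂ : ℝ} (hγ₂ : 0 ≤ γ₂)
    -- (3) uniform fibre bounds of the bond locations
    {m : ℕ}
    (hfibΛ : ∀ Z t (x : UT lamK.Nf), (Finset.univ.filter fun i => (lamK.𝒦 Z t).locΛ i = x).card ≤ m)
    (hfibN : ∀ Z t (x : UT lamK.Nf), (Finset.univ.filter fun j => (lamK.𝒦 Z t).locN j = x).card ≤ m)
    -- (3) THE W-WALKS RUNG ON THE TERMS OF THE STEP OF RECORD (the displayed hypothesis): ONE admissible package with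
    --     positive rates and `η ≤ etaMax` (standard rate book), `TermWalks` for the kernels of every term, round letters,
    --     and PRINT's TWO THRESHOLDS for a `θ₀ > 0`
    (q : WalkPackage) (hq : q.Admissible) (hp : q.PositiveRates) (hη : q.η ≤ q.etaMax) (hαR : α < q.R)
    (hwalks : ∀ Z, ∀ t ∈ terms (θ.ℓ₆ + 1) (lamK.layer.m₃ + 1) Z, TermWalks (lamK.𝒦 Z t) q)
    {KG KCs θ₀ : ℝ} (hKG : q.Kbar ≤ KG) (hKCs : 4 / q.mA ≤ KCs) (hθ₀ : 0 < θ₀)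
    (hαsmall : α ≤ θ₀ * q.R / (4 * q.Kbar + 4))
    (hRσlarge : Real.log ((4 * q.Kbar + 4) / θ₀) / (q.mu / 4 - q.kapCStar) ≤ q.Rσ)
    -- (3) rates below the rung's κ_C⋆, and NODE A's letter ϑ (θ_Γ = θ_E = θ₀, K_Γ = K_G, K₀′ = K_Cs, θ_C derived)
    {kap kap' kap'' kap₂ ϑ : ℝ} (hkap'' : 0 < kap'') (hk1 : kap'' < kap') (hk2 : kap' < kap) (hk3 : kap < kap₂)
    (hk4 : kap₂ < q.kapCStar) (hθ₀le : θ₀ ≤ ϑ)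
    (hθR1le : (m * (1 + 2 / (kap - kap')) ^ lamK.ν) * (m * (1 + 2 / (kap' - kap'')) ^ lamK.ν)
      * (θ₀ * KCs * KG
        + KG * (KCs * θ₀ * (m * (1 + 2 / (q.kapCStar - kap₂)) ^ lamK.ν) * KCs * (m * (1 + 2 / (kap₂ - kap)) ^ lamK.ν)) * KG
        + KG * KCs * θ₀) ≤ ϑ)
    (hsmallKθ : KCs * (m * (1 + 2 / kap) ^ lamK.ν) * (ϑ * (m * (1 + 2 / kap'') ^ lamK.ν)) < 1)
    -- (3) the (2.24)–(2.25) smallness with `a₂₀ = m′·α₄·M⁻⁴(1 + 32/(κ₁−1))⁴`; the eigenvalue bound of C is the NUMBER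
    --     `1∕m_A ≤ cE` (`eigenvalues_C_le_of_termWalks`); the form bound of Γ₀
    {cE gq : ℝ} (hc0 : 0 ≤ cE)
    (hcE : 1 / q.mA ≤ cE)
    (hαc : (2 * (ϑ * (m * (1 + 2 / kap'') ^ lamK.ν)) +
      (γ₂ + m' * lamK.layer.c.α₄ * (lamK.layer.c.M ^ 4)⁻¹ * (1 + 32 / (lamK.layer.c.κ₁ - 1)) ^ 4)) * cE ≤ 1 / 2) (hgq : 0 ≤ gq)
    (hΓq : ∀ Z, ∀ t ∈ terms (θ.ℓ₆ + 1) (lamK.layer.m₃ + 1) Z, ∀ X : (lamK.𝒦 Z t).Λ ⊕ (lamK.𝒦 Z t).C₀ → ℝ,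
      ((lamK.𝒦 Z t).Γ₀ *ᵥ X) ⬝ᵥ ((lamK.𝒦 Z t).C *ᵥ ((lamK.𝒦 Z t).Γ₀ *ᵥ X)) ≤ gq * (X ⬝ᵥ X))
    (hsmall : (2 * (ϑ * (m * (1 + 2 / kap'') ^ lamK.ν)) +
      (γ₂ + m' * lamK.layer.c.α₄ * (lamK.layer.c.M ^ 4)⁻¹ * (1 + 32 / (lamK.layer.c.κ₁ - 1)) ^ 4)) * (1 + 2 * cE * gq) ≤ 1 / 2)
    -- (3) constant matching, p. 17: `a ≤ γ₂ r_P²` and the volume factor with `w = K₀(64,8)·α₄·#(⋃𝐃)`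
    (hPa : a ≤ γ₂ * lamK.rP ^ 2)
    (hvol : ∀ Z, ∀ t ∈ terms (θ.ℓ₆ + 1) (lamK.layer.m₃ + 1) Z,
      2 * (KCs * (m * (1 + 2 / kap) ^ lamK.ν) * (ϑ * (m * (1 + 2 / kap'') ^ lamK.ν))
              * (1 + (1 - KCs * (m * (1 + 2 / kap) ^ lamK.ν) * (ϑ * (m * (1 + 2 / kap'') ^ lamK.ν)))⁻¹) / 2)
          * (Fintype.card (lamK.𝒦 Z t).Λ : ℝ)
        + K₀ 64 8 * lamK.layer.c.α₄ * (((t.1.image Subtype.val).biUnion id).card : ℝ)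
        + (2 * (ϑ * (m * (1 + 2 / kap'') ^ lamK.ν)) +
            (γ₂ + m' * lamK.layer.c.α₄ * (lamK.layer.c.M ^ 4)⁻¹ * (1 + 32 / (lamK.layer.c.κ₁ - 1)) ^ 4)) * cE * (Fintype.card (lamK.𝒦 Z t).Λ : ℝ)
        + (2 * (ϑ * (m * (1 + 2 / kap'') ^ lamK.ν)) +
            (γ₂ + m' * lamK.layer.c.α₄ * (lamK.layer.c.M ^ 4)⁻¹ * (1 + 32 / (lamK.layer.c.κ₁ - 1)) ^ 4)) * (1 + 2 * cE * gq)
            * (Fintype.card ((lamK.𝒦 Z t).Λ ⊕ (lamK.𝒦 Z t).C₀) : ℝ)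
        ≤ a₅ * ((Z.1).card : ℝ)) :
    B13LeafOfRecord θ lamK.layer :=
  b13LeafOfRecord_of_located_walks θ lamK.layer (𝒦 := lamK.𝒦) (uOf := lamK.uOf) (lZ := lamK.lZ) (lD := fun _ t => lamK.lD t) (Γm := lamK.Gam)
    (χY₀ := lamK.chiY₀) (χcP := lamK.chicP) (Pl := lamK.Pl) (Dfam := fun _ t => t.1) (Vr := lamK.Vr) (emb := lamK.emb)
    (hT₃ := fun Z t _ φ _ => lamK.norm_T₃_layer_le Z t φ) (hlZ := fun Z t _ => lamK.lZ_spec Z t) (hlD := fun _ t _ => lamK.lD_spec t)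
    (hlin := fun Z t _ φ _ σ _ X => lamK.Gam_eq Z t φ σ X) (hχc := fun Z t B => lamK.chicP_eq Z t B) (hχ0 := lamK.chiY₀_nonneg) (hχ1 := lamK.chiY₀_le_one)
    (hVr := fun Z t _ φ _ Y _ B _ => lamK.Vr_eq Z t φ Y B) (hrP := lamK.rP_nonneg hε.le)
    hN12 dist hS0Y hFsub hSq hScY hdist0 hdist hSX hSX' hX0 hAnT hAnT' hK hK' hκ hδ1 hδκ hκ126 hκ126' hκ₁ hκ₁' hδ₀M hδ₀M5 hR8 hR9 h124 h130 hθ₁0 hθ₁1 hC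
    hGlAn hGl he hg hK₂ hR hε3 hW hKW hcard hsp hfloor hAnP hG hL8 hN h12 hE hε hC₁ hα hM hτ2 hUσ hUτ hUexp hUtau hr hr' hsubτ hαnn huα hPcard ιb hι cube hQsupp
    hfibc hBv hBv0 hχsupp hΨσ hΨτ hAs hγ₂ hfibΛ hfibN q hq hp hη hαR hwalks hKG hKCs hθ₀ hαsmall hRσlarge hkap'' hk1 hk2 hk3 hk4 hθ₀le hθR1le hsmallKθ hc0 hcE
    hαc hgq hΓq hsmall hPa hvol

end Layer

/-! ## §2. THE FAMILY CURRENCY AT THE KERNEL TOWER — member-wise leaves of the layers of record give the family leaf of record (def-B13 g3's bridge, by name) -/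

section Family

variable {θ : Stage3Params}

/-- **Member-wise leaves of a kernel-keyed family give its family leaf of record** at any box `γ₀` and any letter record `c₀` carried by every member in the box:
node00-def-B13 g3's `b13FamLeafOfRecord_of_forall_b13LeafOfRecord` at `lamKF.layerFam` (each member's leaf is §1 at `lamKF k v`).  Stated once so that a consumer of the
family currency at the tower sees what it owes: the leaves member-wise (§1's located inputs + THE RUNG per member) and the member letters law.  Count-neutral.
[cite: Balaban1988RG2Cluster, Lemmas 1–3 pp.9, 11, 20 and (2.14) p.15; Balaban1987RG1, Thm 3 p.264 (one family, every step)] -/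
theorem b13FamLeafOfRecord_layerFam_of_forall (lamKF : ResidB13KFam θ) {γ₀ : ℝ} {c₀ : B13.Consts}
    (hc : ∀ k v, v ∈ FlowStep.Box γ₀ k → (lamKF k v).c = c₀)
    (hleaf : ∀ k v, v ∈ FlowStep.Box γ₀ k → B13LeafOfRecord θ (lamKF k v).layer) :
    B13FamLeafOfRecord θ γ₀ (ResidB13KFam.layerFam lamKF) { c₀ with L := θ.ℓ₆ + 1 } :=
  b13FamLeafOfRecord_of_forall_b13LeafOfRecord
    (fun k v hv => by rw [ResidB13KFam.layerFam_apply, ResidB13K.c13OfRecord_layer, hc k v hv])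
    (fun k v hv => by rw [ResidB13KFam.layerFam_apply]; exact hleaf k v hv)

end Family

end Summit.QuantumFields.YangMills.BalabanUVNodes.N10B13KernelTowerWalks
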